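import Literature.ModelTheory.ExponentialFields.NewtonSentences
import Literature.ModelTheory.ExponentialFields.NewtonExpSystems
import Literature.ModelTheory.ExponentialFields.RationalExpTermTransfer
import Mathlib.LinearAlgebra.Matrix.Adjugate
import Mathlib.Topology.Instances.Matrix
import HarnessLib

/-!
# Transfer of non-singular zeros through the Newton sentences

Family `periods` (periods.S27), topic `Literature/ModelTheory/ExponentialFields`: node (B7) of the
decomposition of the conditional half of Macintyre–Wilkie's theorem
(`Literature.ModelTheory.ExponentialFields.macintyreWilkie_existential_of_schanuelProperty`).

Jones–Servi 2011 (transposing Macintyre–Wilkie 1996, §4), **Theorem 3.7**: "Let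
`F = (f₁, …, fₙ)`. Suppose that `ℝ^α ⊨ ∃x̄ ∈ V^{reg}(F)`. Then `T ⊢ ∃x̄ ∈ V^{reg}(F)`. *Proof.* Let
`x̄₀ ∈ V^{reg}(F)`. Choose `N` … Compute `θ` … By continuity, we can find `q̄ ∈ ℚⁿ` such that in
`ℝ^α` the following holds: `‖q̄‖ < N ∧ |JF(q̄)| > N⁻¹ ∧ ‖F(q̄)‖ < θ⁻¹` (∗). By Lemma 3.6, in every
model of `T` the inequalities in (∗) hold. We conclude the proof by Lemma 3.5."

This file proves the corresponding statement for `exp`, with the Newton step supplied by the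
sentence `NK_F` (`NewtonSentences.lean`) instead of being derived in `T`:

* **`NewtonExp.exists_zero_of_models_newtonSentence`** (and `…_pd` for the formal-derivative
  instance): if a square system `F` of parameter-free exponential terms has a non-singular zero in
  `ℝⁿ` (and the terms `G` realize to its Jacobian entries), then in every ordered field `K` (in
  `Type`) carrying a lawful `Language.orderedExpRing`-structure whose `exp` is an `IsOrderedExp`
  map and which satisfies `NK_{F,G,H}`, the system `F` has a common zero in `Kⁿ`;
* `NewtonExp.real_models_newtonSentence`: `ℝ ⊨ NK_{F,G,H}` when `G`, `H` realize to the first and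
  second partial derivatives.

The proof follows the printed one: rational data `(q̄, β, δ, ν, d₀)` are chosen in `ℝ` by
continuity at the non-singular zero with *strict* inequalities (`NewtonExp.exists_newtonData`),
the hypothesis `Hyp_F` of `NK_F` is verified in `K` at `q̄` with `B := JF(q̄)⁻¹` computed in `K`
(adjugate over determinant), every needed inequality being a strict inequality between rational
exponential expressions true in `ℝ`, hence true in `K` (`RationalExpTermTransfer.lean` — the rôle
of Lemma 3.6), and `NK_F` fires (`NewtonExp.newtonHyp_of_newtonData`).

## References

* G. O. Jones, T. Servi, *On the decidability of the real field with a generic power function*,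
  J. Symb. Log. 76 (2011), Thm. 3.7 (and Lemmas 3.5, 3.6).
* A. Macintyre, A. J. Wilkie, *On the decidability of the real exponential field* (1996), §4.
-/

noncomputable section

open FirstOrder FirstOrder.Language FirstOrder.Language.Structure Filter Topology Metric
open scoped BigOperators Matrix

namespace Literature.ModelTheory.ExponentialFields

/-! ### More rational exponential expressions: sums, products, determinants, adjugates, majorants -/

namespace RatExpExpr

variable {K : Type*} [Field K] (E : K → K)

/-- sum of a list of expressions [folklore] -/
def sumE : List RatExpExpr → RatExpExpr
  | [] => const 0
  | e :: l => add e (sumE l)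

/-- `eval` of `sumE`. [folklore] -/
@[simp] theorem eval_sumE : ∀ l : List RatExpExpr, eval E (sumE l) = (l.map (eval E)).sum
  | [] => by simp [sumE]
  | e :: l => by simp [sumE, eval_sumE l]

/-- product of a list of expressions [folklore] -/
def prodE : List RatExpExpr → RatExpExpr
  | [] => const 1
  | e :: l => mul e (prodE l)

/-- `eval` of `prodE`. [folklore] -/
@[simp] theorem eval_prodE : ∀ l : List RatExpExpr, eval E (prodE l) = (l.map (eval E)).prod
  | [] => by simp [prodE]
  | e :: l => by simp [prodE, eval_prodE l]

/-- the determinant expression of a square matrix of expressions (Leibniz formula) [folklore] -/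
def detE {m : ℕ} (A : Matrix (Fin m) (Fin m) RatExpExpr) : RatExpExpr :=
  sumE ((Finset.univ : Finset (Equiv.Perm (Fin m))).toList.map fun σ =>
    mul (const (Equiv.Perm.sign σ : ℤ)) (prodE ((List.finRange m).map fun i => A (σ i) i)))

/-- `eval` of the determinant expression is the determinant of the evaluated matrix. [folklore] -/
theorem eval_detE {m : ℕ} (A : Matrix (Fin m) (Fin m) RatExpExpr) :
    eval E (detE A) = (A.map (eval E)).det := by
  rw [detE, eval_sumE, Matrix.det_apply, List.map_map, Finset.sum_map_toList]
  refine Finset.sum_congr rfl fun σ _ => ?_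
  rw [Units.smul_def, zsmul_eq_mul, Fin.prod_univ_def]
  simp only [eval_mul, eval_const, eval_prodE, List.map_map, Function.comp_def, Matrix.map_apply]
  push_cast
  rfl

/-- the `(i, j)` adjugate-entry expression: determinant with row `j` replaced by `eᵢ` [folklore] -/
def adjE {m : ℕ} (A : Matrix (Fin m) (Fin m) RatExpExpr) (i j : Fin m) : RatExpExpr :=
  detE (A.updateRow j fun k => if k = i then const 1 else const 0)

/-- `eval` of the adjugate-entry expression is the adjugate entry (`Matrix.adjugate_apply`). [folklore] -/
theorem eval_adjE {m : ℕ} (A : Matrix (Fin m) (Fin m) RatExpExpr) (i j : Fin m) :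
    eval E (adjE A i j) = (A.map (eval E)).adjugate i j := by
  rw [adjE, eval_detE, Matrix.adjugate_apply]
  congr 1
  ext k l
  simp only [Matrix.map_apply, Matrix.updateRow_apply]
  split_ifs <;> simp [*]

/-- the structural majorant of a parameter-free term at a rational radius, as an expression
(same recursion as `NewtonExp.majEval`) [folklore] -/
def majExpr {n : ℕ} (ν : ℚ) : Language.orderedExpRing.Term (Empty ⊕ Fin n) → RatExpExpr
  | var _ => const ν
  | func expRingFunc.add ts => add ((fun i => majExpr ν (ts i)) 0) ((fun i => majExpr ν (ts i)) 1)
  | func expRingFunc.mul ts => mul ((fun i => majExpr ν (ts i)) 0) ((fun i => majExpr ν (ts i)) 1)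
  | func expRingFunc.neg ts => (fun i => majExpr ν (ts i)) 0
  | func expRingFunc.zero _ => const 0
  | func expRingFunc.one _ => const 1
  | func expRingFunc.exp ts => exp ((fun i => majExpr ν (ts i)) 0)

/-- `eval` of the majorant expression is the majorant value `NewtonExp.majEval`. [folklore] -/
theorem eval_majExpr {n : ℕ} (ν : ℚ) :
    ∀ t : Language.orderedExpRing.Term (Empty ⊕ Fin n),
      eval E (majExpr ν t) = NewtonExp.majEval E (ν : K) t
  | var _ => rfl
  | func expRingFunc.add ts => by
    simp only [majExpr, NewtonExp.majEval, eval_add, eval_majExpr ν (ts 0), eval_majExpr ν (ts 1)]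
  | func expRingFunc.mul ts => by
    simp only [majExpr, NewtonExp.majEval, eval_mul, eval_majExpr ν (ts 0), eval_majExpr ν (ts 1)]
  | func expRingFunc.neg ts => by
    simp only [majExpr, NewtonExp.majEval, eval_majExpr ν (ts 0)]
  | func expRingFunc.zero _ => by simp [majExpr, NewtonExp.majEval]
  | func expRingFunc.one _ => by simp [majExpr, NewtonExp.majEval]
  | func expRingFunc.exp ts => by
    simp only [majExpr, NewtonExp.majEval, eval_exp, eval_majExpr ν (ts 0)]

end RatExpExpr

namespace NewtonExp

open RealExpModel RatExpExpr

variable {n : ℕ} (F : Fin n → Language.orderedExpRing.Term (Empty ⊕ Fin n))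
  (G : Fin n → Fin n → Language.orderedExpRing.Term (Empty ⊕ Fin n))
  (H : Fin n → Fin n → Fin n → Language.orderedExpRing.Term (Empty ⊕ Fin n))

/-! ### The expressions of the Newton data -/

/-- the rational point as a valuation of `Empty ⊕ Fin n` [folklore] -/
def ratPt (q : Fin n → ℚ) : Empty ⊕ Fin n → ℚ := Sum.elim Empty.elim q

/-- In a field `K`, the cast of the rational point is the valuation `Sum.elim Empty.elim (q cast)`. [folklore] -/
theorem cast_ratPt {K : Type*} [Field K] (q : Fin n → ℚ) :
    (fun a => ((ratPt q a : ℚ) : K)) = Sum.elim (Empty.elim : Empty → K) fun i => ((q i : ℚ) : K) := by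
  funext a; rcases a with e | i
  · exact e.elim
  · rfl

/-- the matrix of expressions of the Jacobian entries `G i j (q̄)` [folklore] -/
def jacExpr (q : Fin n → ℚ) : Matrix (Fin n) (Fin n) RatExpExpr :=
  Matrix.of fun i j => ofTerm (ratPt q) (G i j)

/-- the Lipschitz-constant expression `Lip_H(ν)` at a rational `ν` [folklore] -/
def lipExpr (ν : ℚ) : RatExpExpr :=
  sumE ((List.finRange n).map fun i => sumE ((List.finRange n).map fun j =>
    sumE ((List.finRange n).map fun k => majExpr ν (H i j k))))

section EvalK

variable {K : Type*} [Language.orderedExpRing.Structure K] [Field K] [LinearOrder K]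
  [RealExpModel.LawfulStructure K] {E : K → K}
  (hexp : ∀ v : Fin 1 → K, funMap (L := Language.orderedExpRing) expRingFunc.exp v = E (v 0))

include hexp

/-- In `K`, the Jacobian-entry expressions evaluate to the semantic Jacobian `jacM` at the cast point. [folklore] -/
theorem eval_jacExpr (q : Fin n → ℚ) :
    (jacExpr G q).map (eval E) = jacM G (fun i => ((q i : ℚ) : K)) := by
  ext i j
  rw [Matrix.map_apply, jacExpr, Matrix.of_apply, ← realize_eq_eval_ofTerm hexp (ratPt q), cast_ratPt,
    jacM, Matrix.of_apply]

/-- In `K`, the value of `Fᵢ` at the cast point is the evaluation of its expression. [folklore] -/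
theorem realize_eq_eval_at_ratPt (q : Fin n → ℚ) (t : Language.orderedExpRing.Term (Empty ⊕ Fin n)) :
    t.realize (Sum.elim (Empty.elim : Empty → K) fun i => ((q i : ℚ) : K)) = eval E (ofTerm (ratPt q) t) := by
  rw [← cast_ratPt, realize_eq_eval_ofTerm hexp]

omit [Field K] [LinearOrder K] [RealExpModel.LawfulStructure K] in
/-- The interpretation `expM` is `E`. [folklore] -/
theorem expM_eq : expM K = E := by
  funext a
  rw [expM, hexp]
  rfl

omit [LinearOrder K] [RealExpModel.LawfulStructure K] in
/-- In `K`, the Lipschitz expression evaluates to the semantic Lipschitz constant `lipM`. [folklore] -/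
theorem eval_lipExpr (ν : ℚ) : eval E (lipExpr H ν) = lipM H ((ν : ℚ) : K) := by
  simp only [lipExpr, lipM, eval_sumE, List.map_map, Function.comp_def, eval_majExpr, Fin.sum_univ_def,
    expM_eq hexp]

end EvalK

/-! ### Rational Newton data with slack, and their verification in `K` -/

/-- **Rational Newton data for `(F, G, H)`**: a rational point `q̄`, rational `β, δ, ν ≥ 0` and
`d₀ > 0` such that, *in `ℝ`*, strictly: `|det G(q̄)| > d₀`, `|adj G(q̄)ᵢⱼ| < β d₀`, `|Fᵢ(q̄)| < δ`,
`|qᵢ| + 2nβδ < ν` and `4 · Lip_H(ν) · (nβ) · (nβδ) < 1` — the strict forms of the hypotheses of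
`Hyp`, which transfer to every ordered exponential field. [folklore] -/
structure NewtonData where
  /-- the rational approximation of the zero -/ q : Fin n → ℚ
  /-- bound for the entries of `JF(q̄)⁻¹` -/ β : ℚ
  /-- bound for `|Fᵢ(q̄)|` -/ δ : ℚ
  /-- radius of the box -/ ν : ℚ
  /-- lower bound for `|det JF(q̄)|` -/ d₀ : ℚ
  hβ₀ : 0 ≤ β
  hδ₀ : 0 ≤ δ
  hν₀ : 0 ≤ ν
  hd₀ : 0 < d₀
  hdet : (d₀ : ℝ) < |eval Real.exp (detE (jacExpr G q))|
  hadj : ∀ i j, |eval Real.exp (adjE (jacExpr G q) i j)| < β * d₀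
  hF : ∀ i, |eval Real.exp (ofTerm (ratPt q) (F i))| < δ
  hbox : ∀ i, |q i| + 2 * (n * β * δ) < ν
  hsmall : 4 * eval Real.exp (lipExpr H ν) * (n * β) * (n * β * δ) < 1

variable {F G H}

/-- **Verification of `Hyp_F` in an ordered exponential field from rational Newton data**
(the rôle of Jones–Servi 2011, Lemma 3.6 in the proof of Thm. 3.7): with
`B := JF(q̄)⁻¹` computed in `K`. [cite: JonesServi2011, Thm. 3.7 (proof)] -/
theorem newtonHyp_of_newtonData (D : NewtonData F G H) (K : Type) [Field K] [LinearOrder K]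
    [IsStrictOrderedRing K] [Language.orderedExpRing.Structure K] [RealExpModel.LawfulStructure K]
    (E : K → K) (hE : IsOrderedExp E)
    (hexp : ∀ v : Fin 1 → K, funMap (L := Language.orderedExpRing) expRingFunc.exp v = E (v 0)) :
    NewtonHyp F G H (fun i => ((D.q i : ℚ) : K)) (jacM G (fun i => ((D.q i : ℚ) : K)))⁻¹
      ((D.β : ℚ) : K) ((D.δ : ℚ) : K) ((D.ν : ℚ) : K) := by
  set qK : Fin n → K := fun i => ((D.q i : ℚ) : K) with hqK
  set J : Matrix (Fin n) (Fin n) K := jacM G qK with hJ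
  have hJexpr : (jacExpr G D.q).map (eval E) = J := eval_jacExpr G hexp D.q
  -- the determinant in `K` is bounded away from `0`
  have hdetK : ((D.d₀ : ℚ) : K) < |J.det| := by
    rw [← hJexpr, ← eval_detE]
    rcases lt_or_ge 0 (eval Real.exp (detE (jacExpr G D.q))) with hpos | hnonpos
    · have h1 : eval Real.exp (const D.d₀) < eval Real.exp (detE (jacExpr G D.q)) := by
        simpa [abs_of_pos hpos] using D.hdet
      have := eval_lt_eval_of_real h1 K E hE
      simp only [eval_const] at this
      exact this.trans_le (le_abs_self _)
    · have h1 : eval Real.exp (detE (jacExpr G D.q)) < eval Real.exp (const (-D.d₀)) := by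
        have := D.hdet
        rw [abs_of_nonpos hnonpos] at this
        simp only [eval_const, Rat.cast_neg]
        linarith
      have := eval_lt_eval_of_real h1 K E hE
      simp only [eval_const, Rat.cast_neg] at this
      have h2 : ((D.d₀ : ℚ) : K) < -eval E (detE (jacExpr G D.q)) := by linarith
      exact h2.trans_le (neg_le_abs _)
  have hd₀K : (0 : K) < ((D.d₀ : ℚ) : K) := by exact_mod_cast D.hd₀
  have hdet_ne : J.det ≠ 0 := fun h => by
    rw [h, abs_zero] at hdetK
    exact (lt_irrefl _ (hd₀K.trans hdetK))
  have hunit : IsUnit J.det := isUnit_iff_ne_zero.2 hdet_ne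
  refine ⟨by exact_mod_cast D.hβ₀, by exact_mod_cast D.hδ₀, by exact_mod_cast D.hν₀, ?_, ?_, ?_, ?_, ?_⟩
  · -- `B · J = 1`
    exact Matrix.nonsing_inv_mul J hunit
  · -- `|B i j| ≤ β`
    intro i j
    rw [Matrix.inv_def, Matrix.smul_apply, Ring.inverse_eq_inv', smul_eq_mul, abs_mul, abs_inv]
    have hadjK : |J.adjugate i j| < ((D.β : ℚ) : K) * ((D.d₀ : ℚ) : K) := by
      rw [← hJexpr, ← eval_adjE]
      have hlo : eval Real.exp (const (-(D.β * D.d₀))) < eval Real.exp (adjE (jacExpr G D.q) i j) := by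
        have := (abs_lt.1 (D.hadj i j)).1
        simpa using this
      have hhi : eval Real.exp (adjE (jacExpr G D.q) i j) < eval Real.exp (const (D.β * D.d₀)) := by
        have := (abs_lt.1 (D.hadj i j)).2
        simpa using this
      have h1 := eval_lt_eval_of_real hlo K E hE
      have h2 := eval_lt_eval_of_real hhi K E hE
      simp only [eval_const] at h1 h2
      push_cast at h1 h2
      exact abs_lt.2 ⟨h1, h2⟩
    have hdpos : (0 : K) < |J.det| := hd₀K.trans hdetK
    rw [inv_mul_le_iff₀ hdpos]
    calc |J.adjugate i j| ≤ ((D.β : ℚ) : K) * ((D.d₀ : ℚ) : K) := hadjK.le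
      _ ≤ ((D.β : ℚ) : K) * |J.det| := by
          have hβK : (0 : K) ≤ ((D.β : ℚ) : K) := by exact_mod_cast D.hβ₀
          exact mul_le_mul_of_nonneg_left hdetK.le hβK
      _ = |J.det| * ((D.β : ℚ) : K) := mul_comm _ _
  · -- `|F_i(q̄)| ≤ δ`
    intro i
    rw [realize_eq_eval_at_ratPt hexp]
    have hlo : eval Real.exp (const (-D.δ)) < eval Real.exp (ofTerm (ratPt D.q) (F i)) := by
      have := (abs_lt.1 (D.hF i)).1; simpa using this
    have hhi : eval Real.exp (ofTerm (ratPt D.q) (F i)) < eval Real.exp (const D.δ) := by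
      have := (abs_lt.1 (D.hF i)).2; simpa using this
    have h1 := eval_lt_eval_of_real hlo K E hE
    have h2 := eval_lt_eval_of_real hhi K E hE
    simp only [eval_const] at h1 h2
    push_cast at h1 h2
    exact (abs_lt.2 ⟨h1, h2⟩).le
  · -- `|q_i| + 2 n β δ ≤ ν` (rational)
    intro i
    have := (D.hbox i).le
    have h' : ((|D.q i| + 2 * (n * D.β * D.δ) : ℚ) : K) ≤ ((D.ν : ℚ) : K) := Rat.cast_le.2 this
    push_cast at h'
    exact h'
  · -- `4 · Lip(ν) · (nβ) · (nβδ) ≤ 1`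
    rw [← eval_lipExpr H hexp D.ν]
    have h1 : eval Real.exp (mul (mul (mul (const 4) (lipExpr H D.ν)) (const (n * D.β)))
        (const (n * D.β * D.δ))) < eval Real.exp (const 1) := by
      simpa using D.hsmall
    have := eval_lt_eval_of_real h1 K E hE
    simp only [eval_mul, eval_const] at this
    push_cast at this
    exact this.le

/-- **A model of `NK_F` that is an ordered exponential field has a zero of `F`, given rational
Newton data.** [cite: JonesServi2011, Thm. 3.7 (proof)] -/
theorem exists_zero_of_newtonData (D : NewtonData F G H) (K : Type) [Field K] [LinearOrder K]
    [IsStrictOrderedRing K] [Language.orderedExpRing.Structure K] [RealExpModel.LawfulStructure K]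
    (E : K → K) (hE : IsOrderedExp E)
    (hexp : ∀ v : Fin 1 → K, funMap (L := Language.orderedExpRing) expRingFunc.exp v = E (v 0))
    (hNK : K ⊨ newtonSentence F G H) :
    ∃ x : Fin n → K, ∀ i, (F i).realize (Sum.elim (Empty.elim : Empty → K) x) = 0 :=
  realize_newtonSentence_iff.1 hNK _ _ _ _ _ (newtonHyp_of_newtonData D K E hE hexp)

/-! ### Choosing the rational data in `ℝ` by continuity at a non-singular zero -/

/-- In `ℝ`, the Jacobian-entry expressions evaluate to `jacM G` at the cast point. [folklore] -/
theorem eval_jacExpr_real (q : Fin n → ℚ) :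
    (jacExpr G q).map (eval Real.exp) = jacM G (fun i => ((q i : ℚ) : ℝ)) :=
  eval_jacExpr G (fun _ => rfl) q

/-- In `ℝ`, the Lipschitz expression evaluates to `Σ majFun ν (H i j k)`. [folklore] -/
theorem eval_lipExpr_real (ν : ℚ) :
    eval Real.exp (lipExpr H ν) = ∑ i, ∑ j, ∑ k, majFun ((ν : ℚ) : ℝ) (H i j k) := by
  rw [eval_lipExpr H (fun _ => rfl) ν, lipM]
  simp only [expM_real, majEval_real]

/-- Rational points of `ℚⁿ` are dense in `ℝⁿ` (coordinatewise `exists_rat_btwn`). [folklore] -/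
theorem exists_rat_near (a : Fin n → ℝ) {ε : ℝ} (hε : 0 < ε) :
    ∃ q : Fin n → ℚ, ∀ i, |((q i : ℚ) : ℝ) - a i| < ε := by
  have : ∀ i, ∃ r : ℚ, |((r : ℚ) : ℝ) - a i| < ε := fun i => by
    obtain ⟨r, h1, h2⟩ := exists_rat_btwn (show a i - ε < a i + ε by linarith)
    exact ⟨r, abs_lt.2 ⟨by linarith, by linarith⟩⟩
  choose q hq using this
  exact ⟨q, hq⟩

/-- **Rational Newton data exist at a non-singular real zero** (Jones–Servi 2011, proof of
Thm. 3.7: "By continuity, we can find `q̄ ∈ ℚⁿ` such that …"): all quantities in `Hyp_F` are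
continuous functions of the point, the determinant is nonzero and the entries of the inverse
Jacobian are bounded near the zero, so rational data with strict inequalities can be chosen. [cite: JonesServi2011, Thm. 3.7 (proof)] -/
theorem exists_newtonData
    (hG : ∀ (y : Fin n → ℝ) (i j : Fin n), jacFun F y i j = (G i j).realize (Sum.elim Empty.elim y))
    {a : Fin n → ℝ} (ha : sysFun F Empty.elim a = 0)
    (hJ : (jacFun F a).det ≠ 0) : Nonempty (NewtonData F G H) := by
  classical
  have hGmat : ∀ y : Fin n → ℝ, jacM G y = jacFun F y := fun y => by
    ext i j; rw [hG y i j]; rfl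
  -- the radius of the box
  obtain ⟨ν, hν⟩ := exists_rat_gt (‖a‖ + 1)
  have hν₀ : (0 : ℚ) ≤ ν := by
    have : (0 : ℝ) ≤ ν := (by positivity : (0:ℝ) ≤ ‖a‖ + 1).trans hν.le
    exact_mod_cast this
  -- a Lipschitz value on that box
  set Lip : ℝ := ∑ i, ∑ j, ∑ k, majFun ((ν : ℚ) : ℝ) (H i j k) with hLip
  have hLip₀ : 0 ≤ Lip := Finset.sum_nonneg fun _ _ => Finset.sum_nonneg fun _ _ =>
    Finset.sum_nonneg fun _ _ => majFun_nonneg (by exact_mod_cast hν₀) _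
  -- bound `β` for the entries of the inverse Jacobian at `a` (with slack)
  set Dt : ℝ := |(jacFun F a).det| with hDt
  have hDt : 0 < Dt := abs_pos.2 hJ
  set Am : ℝ := ∑ i, ∑ j, |(jacFun F a).adjugate i j| with hAm
  have hAm₀ : 0 ≤ Am := Finset.sum_nonneg fun _ _ => Finset.sum_nonneg fun _ _ => abs_nonneg _
  obtain ⟨β, hβ⟩ := exists_rat_gt (Am / Dt + 1)
  have hβpos : (0 : ℝ) < β := lt_of_le_of_lt (by positivity) hβ
  have hβ₀ : (0 : ℚ) ≤ β := by exact_mod_cast hβpos.le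
  -- `δ` small
  obtain ⟨δ, hδ₀', hδ⟩ := exists_rat_btwn (show (0 : ℝ) <
      min (1 / (4 * (n : ℝ) * β + 4)) (1 / (4 * Lip * (n * β) * (n * β) + 4)) by positivity)
  have hδpos : (0 : ℝ) < δ := by exact_mod_cast hδ₀'
  have hδ₀ : (0 : ℚ) ≤ δ := by exact_mod_cast hδpos.le
  have hδ1 : (δ : ℝ) < 1 / (4 * (n : ℝ) * β + 4) := lt_of_lt_of_le hδ (min_le_left _ _)
  have hδ2 : (δ : ℝ) < 1 / (4 * Lip * (n * β) * (n * β) + 4) := lt_of_lt_of_le hδ (min_le_right _ _)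
  have hsmallR : 4 * Lip * (n * β) * (n * β * δ) < 1 := by
    have hpos : (0 : ℝ) < 4 * Lip * (n * β) * (n * β) + 4 := by positivity
    have := (lt_div_iff₀ hpos).1 hδ2
    nlinarith
  have hrad : 2 * ((n : ℝ) * β * δ) < 1 / 2 := by
    have hpos : (0 : ℝ) < 4 * (n : ℝ) * β + 4 := by positivity
    have := (lt_div_iff₀ hpos).1 hδ1
    nlinarith
  -- `d₀` between `Am / β` and `Dt`
  have hAmβ : Am / β < Dt := by
    rw [div_lt_iff₀ hβpos]
    have : Am / Dt < β := by linarith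
    rw [div_lt_iff₀ hDt] at this
    linarith
  obtain ⟨d₀, hd₀lo, hd₀hi⟩ := exists_rat_btwn (show max (Am / β) 0 < Dt from max_lt hAmβ hDt)
  have hd₀pos : (0 : ℝ) < d₀ := lt_of_le_of_lt (le_max_right _ _) hd₀lo
  have hd₀ : (0 : ℚ) < d₀ := by exact_mod_cast hd₀pos
  have hAm_lt : Am < β * d₀ := by
    have := lt_of_le_of_lt (le_max_left _ _) hd₀lo
    rw [div_lt_iff₀ hβpos] at this
    linarith
  -- continuity at `a` of: det, adjugate entries, `F_i`, coordinates
  have hcontJ : Continuous fun x => jacFun F x := by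
    refine continuous_matrix fun i j => ?_
    exact continuous_realize (termPDeriv j (F i)) Empty.elim
  have hdet_ev : ∀ᶠ x in 𝓝 a, (d₀ : ℝ) < |(jacFun F x).det| :=
    (hcontJ.matrix_det.abs.continuousAt).eventually_const_lt hd₀hi
  have hadj_ev : ∀ᶠ x in 𝓝 a, ∀ i j, |(jacFun F x).adjugate i j| < β * d₀ := by
    have hsum : ContinuousAt (fun x => ∑ i, ∑ j, |(jacFun F x).adjugate i j|) a := by
      refine (continuous_finsetSum _ fun i _ => continuous_finsetSum _ fun j _ => ?_).continuousAt
      exact ((continuous_apply j).comp ((continuous_apply i).comp hcontJ.matrix_adjugate)).abs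
    have hev := hsum.eventually_lt_const hAm_lt
    refine hev.mono fun x hx i j => lt_of_le_of_lt ?_ hx
    have h1 : |(jacFun F x).adjugate i j| ≤ ∑ j', |(jacFun F x).adjugate i j'| :=
      Finset.single_le_sum (f := fun j' => |(jacFun F x).adjugate i j'|) (fun _ _ => abs_nonneg _)
        (Finset.mem_univ j)
    have h2 : ∑ j', |(jacFun F x).adjugate i j'| ≤ ∑ i', ∑ j', |(jacFun F x).adjugate i' j'| :=
      Finset.single_le_sum (f := fun i' => ∑ j', |(jacFun F x).adjugate i' j'|)
        (fun _ _ => Finset.sum_nonneg fun _ _ => abs_nonneg _) (Finset.mem_univ i)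
    exact h1.trans h2
  have hF_ev : ∀ᶠ x in 𝓝 a, ∀ i, |(F i).realize (Sum.elim (Empty.elim : Empty → ℝ) x)| < δ := by
    refine eventually_all.2 fun i => ?_
    have hc : ContinuousAt (fun x => |(F i).realize (Sum.elim (Empty.elim : Empty → ℝ) x)|) a :=
      (continuous_realize (F i) Empty.elim).abs.continuousAt
    have h0 : |(F i).realize (Sum.elim (Empty.elim : Empty → ℝ) a)| < δ := by
      have : (F i).realize (Sum.elim (Empty.elim : Empty → ℝ) a) = 0 := congrFun ha i
      rw [this, abs_zero]; exact hδpos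
    exact hc.eventually_lt_const h0
  have hnear_ev : ∀ᶠ x in 𝓝 a, ‖x - a‖ < 1 / 2 := by
    have : ContinuousAt (fun x => ‖x - a‖) a := (continuous_id.sub continuous_const).norm.continuousAt
    have h0 : ‖a - a‖ < (1 : ℝ) / 2 := by simp
    exact this.eventually_lt_const h0
  obtain ⟨ε, hε, hball⟩ := Metric.eventually_nhds_iff.1 (((hdet_ev.and hadj_ev).and hF_ev).and hnear_ev)
  -- a rational point in the ball
  obtain ⟨q, hq⟩ := exists_rat_near a (show 0 < min ε 1 by positivity)
  set qR : Fin n → ℝ := fun i => ((q i : ℚ) : ℝ) with hqR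
  have hqdist : dist qR a < ε := by
    rw [dist_eq_norm]
    have hlt : ‖qR - a‖ < min ε 1 :=
      (pi_norm_lt_iff (by positivity)).2 fun i => by simpa [qR, Real.norm_eq_abs] using hq i
    exact lt_of_lt_of_le hlt (min_le_left ε 1)
  obtain ⟨⟨⟨hdet_q, hadj_q⟩, hF_q⟩, hnear_q⟩ := hball hqdist
  refine ⟨⟨q, β, δ, ν, d₀, hβ₀, hδ₀, hν₀, hd₀, ?_, ?_, ?_, ?_, ?_⟩⟩
  · rwa [eval_detE, eval_jacExpr_real, hGmat]
  · intro i j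
    rw [eval_adjE, eval_jacExpr_real, hGmat]
    exact_mod_cast hadj_q i j
  · intro i
    rw [← realize_eq_eval_at_ratPt (E := Real.exp) (fun _ => rfl)]
    exact_mod_cast hF_q i
  · intro i
    have h1 : |((q i : ℚ) : ℝ)| ≤ ‖a‖ + 1 / 2 := by
      have h2 : |((q i : ℚ) : ℝ) - a i| ≤ ‖qR - a‖ := by
        simpa [qR, Real.norm_eq_abs] using norm_le_pi_norm (qR - a) i
      have h3 : |a i| ≤ ‖a‖ := by simpa [Real.norm_eq_abs] using norm_le_pi_norm a i
      have h4 := abs_sub_abs_le_abs_sub ((q i : ℚ) : ℝ) (a i)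
      linarith
    have : (|q i| : ℝ) + 2 * (n * β * δ) < ν := by linarith
    exact_mod_cast this
  · rw [eval_lipExpr_real]
    exact_mod_cast hsmallR

/-- **Transfer of non-singular zeros through `NK_{F,G,H}`** (Jones–Servi 2011, Thm. 3.7, for `exp`, with
the Newton step adjoined as the sentence `NK_F`): if the square system `F` of parameter-free
exponential terms has a non-singular zero in `ℝⁿ`, then `F` has a common zero in every ordered
field `K` (in `Type`) with a lawful structure whose `exp` is an `IsOrderedExp` map and which
satisfies `NK_F`. [cite: JonesServi2011, Thm. 3.7] -/
theorem exists_zero_of_models_newtonSentence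
    (hG : ∀ (y : Fin n → ℝ) (i j : Fin n), jacFun F y i j = (G i j).realize (Sum.elim Empty.elim y))
    {a : Fin n → ℝ} (ha : sysFun F Empty.elim a = 0)
    (hJ : (jacFun F a).det ≠ 0) (K : Type) [Field K] [LinearOrder K] [IsStrictOrderedRing K]
    [Language.orderedExpRing.Structure K] [RealExpModel.LawfulStructure K] (E : K → K)
    (hE : IsOrderedExp E)
    (hexp : ∀ v : Fin 1 → K, funMap (L := Language.orderedExpRing) expRingFunc.exp v = E (v 0))
    (hNK : K ⊨ newtonSentence F G H) :
    ∃ x : Fin n → K, ∀ i, (F i).realize (Sum.elim (Empty.elim : Empty → K) x) = 0 := by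
  obtain ⟨D⟩ := exists_newtonData (F := F) (G := G) (H := H) hG ha hJ
  exact exists_zero_of_newtonData D K E hE hexp hNK

/-- The same for the formal-derivative instance `NK_F = NK_{F, ∂F, ∂²F}` (no identification
hypothesis). [cite: JonesServi2011, Thm. 3.7] -/
theorem exists_zero_of_models_newtonSentence_pd {a : Fin n → ℝ} (ha : sysFun F Empty.elim a = 0)
    (hJ : (jacFun F a).det ≠ 0) (K : Type) [Field K] [LinearOrder K] [IsStrictOrderedRing K]
    [Language.orderedExpRing.Structure K] [RealExpModel.LawfulStructure K] (E : K → K)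
    (hE : IsOrderedExp E)
    (hexp : ∀ v : Fin 1 → K, funMap (L := Language.orderedExpRing) expRingFunc.exp v = E (v 0))
    (hNK : K ⊨ newtonSentence F (pdTerms F) (pd2Terms F)) :
    ∃ x : Fin n → K, ∀ i, (F i).realize (Sum.elim (Empty.elim : Empty → K) x) = 0 :=
  exists_zero_of_models_newtonSentence (fun _ _ _ => rfl) ha hJ K E hE hexp hNK

/-! ### `ℝ ⊨ NK_{F,G,H}` -/

/-- **The Newton sentences are true in `ℝ_exp`** whenever `G` realizes to the Jacobian entries
and `H` to their partial derivatives (from `NewtonExp.exists_zero_of_newtonHyp_of_terms`). [cite: JonesServi2011, Lemma 3.5 (proof)] -/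
theorem real_models_newtonSentence
    (hG : ∀ (y : Fin n → ℝ) (i j : Fin n), jacFun F y i j = (G i j).realize (Sum.elim Empty.elim y))
    (hH : ∀ (y : Fin n → ℝ) (i j k : Fin n),
      fderiv ℝ (fun y : Fin n → ℝ => (G i j).realize (Sum.elim Empty.elim y)) y (Pi.single k 1) =
        (H i j k).realize (Sum.elim Empty.elim y)) :
    ℝ ⊨ newtonSentence F G H := by
  rw [realize_newtonSentence_iff]
  intro q B β δ ν h
  have hlip : lipM H ν = ∑ i, ∑ j, ∑ k, majFun ν (H i j k) := by
    rw [lipM]; simp only [expM_real, majEval_real]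
  obtain ⟨x, -, hx, -⟩ := exists_zero_of_newtonHyp_of_terms F G H hG hH h.hβ₀ h.hδ₀ h.hν₀ h.hB
    h.hβ h.hδ h.hν (by rw [← hlip]; exact h.hsmall)
  exact ⟨x, fun i => congrFun hx i⟩

end NewtonExp

end Literature.ModelTheory.ExponentialFields

end
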